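import Literature.NumberTheory.PAdicHodge.BmaxPlusLog
import Literature.NumberTheory.PAdicHodge.FontaineThetaField
import HarnessLib

/-!
# Fontaine's `θ` on `B⁰_max = 𝔸_inf[ξ/p]` and on `A_max = B_max⁺(F)`

Topic `Literature/NumberTheory/PAdicHodge`; namespace `Literature.NumberTheory.PAdicHodge`. Continuation of `BmaxZero`,
`BmaxPlus`, `BmaxPlusLog` (Colmez's integral crystalline ring `A_max = B_max⁺(F)`, the `p`-adic completion of
`B⁰_max = 𝔸_inf[ξ/p] ⊆ 𝔸_inf[1/p]`). Since `θ(ξ) = 0`, Fontaine's `θ[1/p] : 𝔸_inf[1/p] → ℂ_F` kills `ξ/p`, so it maps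
`B⁰_max` into `𝒪_{ℂ_F}` and — `𝒪_{ℂ_F}` being `p`-adically complete — extends to the `p`-adic completion:

* `thetaBmaxZero : B⁰_max →+* 𝒪_{ℂ_F}` — **`θ` on `B⁰_max`** (`θ(ξ/p) = 0`, `θ ∘ (𝔸_inf → B⁰_max) = θ`:
  `thetaBmaxZero_omegaB`, `thetaBmaxZero_algebraMap`), with **`ker θ|_{B⁰_max} = (ξ/p)·B⁰_max`**
  (`thetaBmaxZero_eq_zero_iff`);
* `thetaBmaxPlus : B_max⁺(F) →+* 𝒪_{ℂ_F}` — **`θ` on `A_max = B_max⁺(F)`** (adic-completion functoriality + `𝒪_{ℂ_F} ≅ (𝒪_{ℂ_F})^_(p)`),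
  with the level formula `mk_pow_thetaBmaxPlus` (`θ(x) mod pⁿ = θ̄(x mod pⁿ)`), `thetaBmaxPlus_ainfToBmaxPlus` (`θ ∘ (𝔸_inf → A_max) = θ`)
  and **`θ(t) = 0`** for Fontaine's `t = log[ε] ∈ A_max` (`thetaBmaxPlus_tBmax`);
* the comparison of the `p`-adic filtration of `B⁰_max` with `𝔸_inf`: **`𝔸_inf ∩ p·B⁰_max = (p, ξ)`**
  (`mem_span_p_xi_iff_algebraMap_mem`), and `p·B⁰_max ≠ B⁰_max` (`span_natCast_bmaxZero_ne_top`).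

These are bricks B5/B7 of the φ-road of line `kato_lever` (crux K★ `stmt-BirchSwinnertonDyer-22226`, memo
`Cruxes/StarredOptimalManinUnitFiveSeven/Lines/kato-lever-K2-phi-road.md`): the inputs of `(A_max)^{φ=1} = ℤ_p` and of
Fontaine's lemma `(A_max)^{φ=p} ∩ ker θ ⊆ ℚ_p·t`. Definitions: `thetaBmaxZero`, `thetaBmaxPlus`. No named facts, no
instances. Infrastructure only: BSD / K★ are not proved by any of this.

## References
* [Colmez1998Annals] P. Colmez, *Théorie d'Iwasawa des représentations de de Rham d'un corps local*, Ann. of Math. 148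
  (1998), §III.2 (`A_max`, `B_max⁺`, `θ` on them).
* [FontaineAsterisque223III] J.-M. Fontaine, *Le corps des périodes p-adiques*, Astérisque 223 (1994), Exp. II §1.2, §2.3.
* [BergerLaurent2002] L. Berger, *Représentations p-adiques et équations différentielles*, Invent. Math. 148 (2002), §1.2.
-/

noncomputable section

open WittVector Field ValuativeRel Polynomial Finset
open Literature.AlgebraicGeometry.Resolution

namespace Literature.NumberTheory.PAdicHodge

open Literature.NumberTheory.GaloisRepresentations
open Literature.NumberTheory.GaloisRepresentations.IsNonarchimedeanLocalField

variable {F : Type} [Field F] [ValuativeRel F] [TopologicalSpace F] [IsNonarchimedeanLocalField F]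
  [CharZero F] {p : ℕ} [Fact p.Prime] [Fact (¬ IsUnit (p : integerC F))]
  [IsAdicComplete (Ideal.span {(p : integerC F)}) (integerC F)]

/-! ### `θ[1/p]` on `𝔸_inf` and on `ξ/p` -/

omit [CharZero F] in
/-- `θ[1/p](p) = p`. [cite: Colmez1998Annals, §III.2] -/
theorem fontaineThetaInvertP_natCast :
    fontaineThetaInvertP (integerC F) p
        (algebraMap (Ainf (p := p) F) (Localization.Away (p : Ainf (p := p) F)) (p : Ainf (p := p) F)) =
      algebraMap (integerC F) (Localization.Away (p : integerC F)) (p : integerC F) := by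
  rw [fontaineThetaInvertP_algebraMap, map_natCast]

omit [CharZero F] in
/-- **`θ[1/p](ξ/p) = 0`** (`p · θ[1/p](ξ/p) = θ(ξ) = 0` and `p` is a unit of `𝒪_{ℂ_F}[1/p]`).
[cite: Colmez1998Annals, §III.2] -/
theorem fontaineThetaInvertP_xiDivP : fontaineThetaInvertP (integerC F) p (xiDivP F p) = 0 := by
  have h := congrArg (fontaineThetaInvertP (integerC F) p) (algebraMap_natCast_mul_xiDivP (F := F) (p := p))
  rw [map_mul, fontaineThetaInvertP_natCast, fontaineThetaInvertP_algebraMap, fontaineTheta_xi, map_zero] at h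
  exact ((IsLocalization.Away.algebraMap_isUnit (S := Localization.Away (p : integerC F)) (p : integerC F)).mul_right_eq_zero).1 h

omit [CharZero F] in
/-- **`θ[1/p](B⁰_max) ⊆ 𝒪_{ℂ_F}`**: the image of `B⁰_max = 𝔸_inf[ξ/p]` under `θ[1/p]` lies in (the image of) `𝒪_{ℂ_F}`.
[cite: Colmez1998Annals, §III.2] -/
theorem fontaineThetaInvertP_mem_range_of_mem {x : Localization.Away (p : Ainf (p := p) F)} (hx : x ∈ bmaxZero F p) :
    fontaineThetaInvertP (integerC F) p x ∈ (algebraMap (integerC F) (Localization.Away (p : integerC F))).range := by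
  refine Algebra.adjoin_induction (fun y hy => ?_) (fun r => ?_) (fun y z _ _ hy hz => ?_) (fun y z _ _ hy hz => ?_) hx
  · rw [Set.mem_singleton_iff.1 hy, fontaineThetaInvertP_xiDivP]
    exact zero_mem _
  · rw [fontaineThetaInvertP_algebraMap]
    exact ⟨_, rfl⟩
  · rw [map_add]; exact add_mem hy hz
  · rw [map_mul]; exact mul_mem hy hz

omit [Fact p.Prime] [Fact (¬ IsUnit (p : integerC F))] [IsAdicComplete (Ideal.span {(p : integerC F)}) (integerC F)] in
/-- `p ≠ 0` in `𝒪_{ℂ_F}`. [cite: Colmez1998Annals, §III.2] -/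
theorem natCast_integerC_ne_zero (hp0 : p ≠ 0) : (p : integerC F) ≠ 0 := fun h => by
  have h' := congrArg (fun z : integerC F => (z : CompletedAlgClosure F)) h
  simp only [coe_natCast_integerC, ZeroMemClass.coe_zero] at h'
  exact natCast_C_ne_zero hp0 h'

omit [Fact (¬ IsUnit (p : integerC F))] [IsAdicComplete (Ideal.span {(p : integerC F)}) (integerC F)] in
/-- **`𝒪_{ℂ_F} → 𝒪_{ℂ_F}[1/p]` is injective** (`𝒪_{ℂ_F}` is a domain of characteristic `0`). [cite: Colmez1998Annals, §III.2] -/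
theorem algebraMap_integerC_away_injective :
    Function.Injective (algebraMap (integerC F) (Localization.Away (p : integerC F))) :=
  IsLocalization.injective (Localization.Away (p : integerC F))
    (powers_le_nonZeroDivisors_of_noZeroDivisors (natCast_integerC_ne_zero (F := F) (Fact.out : p.Prime).ne_zero))

/-! ### `θ` on `B⁰_max` -/

omit [CharZero F] in
/-- The value `θ[1/p](x) ∈ 𝒪_{ℂ_F}` for `x ∈ B⁰_max`, as an existence statement. [cite: Colmez1998Annals, §III.2] -/
theorem exists_algebraMap_eq_fontaineThetaInvertP (x : bmaxZero F p) :
    ∃ c : integerC F, algebraMap (integerC F) (Localization.Away (p : integerC F)) c =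
      fontaineThetaInvertP (integerC F) p (x : Localization.Away (p : Ainf (p := p) F)) :=
  RingHom.mem_range.1 (fontaineThetaInvertP_mem_range_of_mem x.2)

variable (F p) in
/-- **Fontaine's `θ` on `B⁰_max = 𝔸_inf[ξ/p]`**, with values in `𝒪_{ℂ_F}`: the restriction of `θ[1/p]` (whose values on
`B⁰_max` are integral, `fontaineThetaInvertP_mem_range_of_mem`). [cite: Colmez1998Annals, §III.2] -/
def thetaBmaxZero : bmaxZero F p →+* integerC F where
  toFun x := Classical.choose (exists_algebraMap_eq_fontaineThetaInvertP x)
  map_one' := algebraMap_integerC_away_injective (by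
    rw [Classical.choose_spec (exists_algebraMap_eq_fontaineThetaInvertP (1 : bmaxZero F p)), map_one,
      Subalgebra.coe_one, map_one])
  map_mul' x y := algebraMap_integerC_away_injective (by
    rw [Classical.choose_spec (exists_algebraMap_eq_fontaineThetaInvertP (x * y)), map_mul,
      Classical.choose_spec (exists_algebraMap_eq_fontaineThetaInvertP x),
      Classical.choose_spec (exists_algebraMap_eq_fontaineThetaInvertP y), Subalgebra.coe_mul, map_mul])
  map_zero' := algebraMap_integerC_away_injective (by
    rw [Classical.choose_spec (exists_algebraMap_eq_fontaineThetaInvertP (0 : bmaxZero F p)), map_zero,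
      Subalgebra.coe_zero, map_zero])
  map_add' x y := algebraMap_integerC_away_injective (by
    rw [Classical.choose_spec (exists_algebraMap_eq_fontaineThetaInvertP (x + y)), map_add,
      Classical.choose_spec (exists_algebraMap_eq_fontaineThetaInvertP x),
      Classical.choose_spec (exists_algebraMap_eq_fontaineThetaInvertP y), Subalgebra.coe_add, map_add])

/-- **`thetaBmaxZero` is `θ[1/p]` restricted to `B⁰_max`.** [cite: Colmez1998Annals, §III.2] -/
theorem algebraMap_thetaBmaxZero (x : bmaxZero F p) :
    algebraMap (integerC F) (Localization.Away (p : integerC F)) (thetaBmaxZero F p x) =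
      fontaineThetaInvertP (integerC F) p (x : Localization.Away (p : Ainf (p := p) F)) :=
  Classical.choose_spec (exists_algebraMap_eq_fontaineThetaInvertP x)

/-- **`θ ∘ (𝔸_inf → B⁰_max) = θ`.** [cite: Colmez1998Annals, §III.2] -/
theorem thetaBmaxZero_algebraMap (a : Ainf (p := p) F) :
    thetaBmaxZero F p (algebraMap (Ainf (p := p) F) (bmaxZero F p) a) = fontaineTheta (integerC F) p a :=
  algebraMap_integerC_away_injective (by
    rw [algebraMap_thetaBmaxZero, coe_algebraMap_bmaxZero, fontaineThetaInvertP_algebraMap])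

/-- **`θ(ξ/p) = 0`.** [cite: Colmez1998Annals, §III.2] -/
theorem thetaBmaxZero_omegaB : thetaBmaxZero F p (omegaB : bmaxZero F p) = 0 :=
  algebraMap_integerC_away_injective (by
    rw [algebraMap_thetaBmaxZero, map_zero]
    exact fontaineThetaInvertP_xiDivP)

/-- `θ(p) = p` on `B⁰_max`. [cite: Colmez1998Annals, §III.2] -/
theorem thetaBmaxZero_natCast (n : ℕ) : thetaBmaxZero F p (n : bmaxZero F p) = n := map_natCast _ n

/-- `θ` maps the ideal `(p)` of `B⁰_max` into the ideal `(p)` of `𝒪_{ℂ_F}`. [cite: Colmez1998Annals, §III.2] -/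
theorem map_thetaBmaxZero_span_le :
    (Ideal.span {(p : bmaxZero F p)}).map (thetaBmaxZero F p) ≤ Ideal.span {(p : integerC F)} := by
  rw [Ideal.map_span, Set.image_singleton, thetaBmaxZero_natCast]

/-- `θ` maps `pⁿ B⁰_max` into `pⁿ 𝒪_{ℂ_F}`. [cite: Colmez1998Annals, §III.2] -/
theorem thetaBmaxZero_mem_pow_of_mem {n : ℕ} {y : bmaxZero F p} (hy : y ∈ Ideal.span {(p : bmaxZero F p)} ^ n) :
    thetaBmaxZero F p y ∈ Ideal.span {(p : integerC F)} ^ n := by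
  rw [Ideal.span_singleton_pow, Ideal.mem_span_singleton'] at hy ⊢
  obtain ⟨z, rfl⟩ := hy
  exact ⟨thetaBmaxZero F p z, by rw [map_mul, map_pow, thetaBmaxZero_natCast]⟩

/-! ### Structure of `B⁰_max = 𝔸_inf[ξ/p]`: `y = (ξ/p)·z + a` and `ker θ = (ξ/p)` -/

omit [CharZero F] [IsAdicComplete (Ideal.span {(p : integerC F)}) (integerC F)] in
/-- **Every `y ∈ B⁰_max` is `(ξ/p)·z + a`** with `z ∈ B⁰_max` and `a ∈ 𝔸_inf` (write `y = q(ξ/p)` with `q ∈ 𝔸_inf[X]` and split off the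
constant term). [cite: BergerLaurent2002, §1.2] -/
theorem exists_eq_omegaB_mul_add_algebraMap (y : bmaxZero F p) :
    ∃ (z : bmaxZero F p) (a : Ainf (p := p) F), y = omegaB * z + algebraMap (Ainf (p := p) F) (bmaxZero F p) a := by
  have hy : (y : Localization.Away (p : Ainf (p := p) F)) ∈ (aeval (xiDivP F p) : (Ainf (p := p) F)[X] →ₐ[Ainf (p := p) F]
      Localization.Away (p : Ainf (p := p) F)).range := by
    rw [← Algebra.adjoin_singleton_eq_range_aeval]; exact y.2
  obtain ⟨q, hq⟩ := hy
  refine ⟨⟨aeval (xiDivP F p) q.divX, Polynomial.aeval_mem_adjoin_singleton _ _⟩, q.coeff 0, Subtype.ext ?_⟩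
  rw [Subalgebra.coe_add, Subalgebra.coe_mul, coe_algebraMap_bmaxZero, ← hq]
  change aeval (xiDivP F p) q = xiDivP F p * aeval (xiDivP F p) q.divX + _
  conv_lhs => rw [← Polynomial.X_mul_divX_add q]
  rw [map_add, map_mul, aeval_X, aeval_C]

/-- `θ((ξ/p)·z + a) = θ(a)`. [cite: Colmez1998Annals, §III.2] -/
theorem thetaBmaxZero_omegaB_mul_add (z : bmaxZero F p) (a : Ainf (p := p) F) :
    thetaBmaxZero F p (omegaB * z + algebraMap (Ainf (p := p) F) (bmaxZero F p) a) = fontaineTheta (integerC F) p a := by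
  rw [map_add, map_mul, thetaBmaxZero_omegaB, zero_mul, zero_add, thetaBmaxZero_algebraMap]

/-- **`ker θ|_{B⁰_max} = (ξ/p)·B⁰_max`**: `θ(y) = 0 ↔ y = (ξ/p)·z` for some `z ∈ B⁰_max` (with `y = (ξ/p)z + a`, `θ(y) = θ(a) = 0`
forces `a = ξc = (ξ/p)·pc`, `ker θ = ξ𝔸_inf`). [cite: Colmez1998Annals, §III.2] -/
theorem thetaBmaxZero_eq_zero_iff (y : bmaxZero F p) :
    thetaBmaxZero F p y = 0 ↔ ∃ z : bmaxZero F p, y = omegaB * z := by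
  constructor
  · intro hy
    obtain ⟨z, a, rfl⟩ := exists_eq_omegaB_mul_add_algebraMap y
    rw [thetaBmaxZero_omegaB_mul_add] at hy
    obtain ⟨c, rfl⟩ := xi_dvd_of_fontaineTheta_eq_zero hy
    refine ⟨z + (p : bmaxZero F p) * algebraMap (Ainf (p := p) F) (bmaxZero F p) c, ?_⟩
    rw [map_mul, ← natCast_mul_omegaB]; ring
  · rintro ⟨z, rfl⟩
    rw [map_mul, thetaBmaxZero_omegaB, zero_mul]

/-! ### `𝔸_inf ∩ p·B⁰_max = (p, ξ)` -/

omit [CharZero F] [IsAdicComplete (Ideal.span {(p : integerC F)}) (integerC F)] in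
/-- `(p, ξ)𝔸_inf ↦ p·B⁰_max` (`ξ = p·(ξ/p)`). [cite: BergerLaurent2002, §1.2] -/
theorem algebraMap_mem_span_of_mem_span_p_xi {a : Ainf (p := p) F} (ha : a ∈ Ideal.span {(p : Ainf (p := p) F), xi}) :
    algebraMap (Ainf (p := p) F) (bmaxZero F p) a ∈ Ideal.span {(p : bmaxZero F p)} := by
  obtain ⟨u, v, rfl⟩ := Ideal.mem_span_pair.1 ha
  rw [map_add, map_mul, map_mul, map_natCast, ← natCast_mul_omegaB]
  exact Ideal.add_mem _ (Ideal.mul_mem_left _ _ (Ideal.mem_span_singleton_self _))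
    (Ideal.mul_mem_left _ _ (Ideal.mul_mem_right _ _ (Ideal.mem_span_singleton_self _)))

/-- **`𝔸_inf ∩ p·B⁰_max ⊆ (p, ξ)`**: if `a ∈ 𝔸_inf` becomes divisible by `p` in `B⁰_max` then `θ(a) ∈ p𝒪_{ℂ_F}`, so
`a ∈ θ⁻¹(p𝒪_{ℂ_F}) = (p, ξ)` (`θ` surjective with kernel `(ξ)`). [cite: Colmez1998Annals, §III.2] -/
theorem mem_span_p_xi_of_algebraMap_mem (hF : Function.Surjective (fontaineTheta (integerC F) p)) {a : Ainf (p := p) F}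
    (ha : algebraMap (Ainf (p := p) F) (bmaxZero F p) a ∈ Ideal.span {(p : bmaxZero F p)}) :
    a ∈ Ideal.span {(p : Ainf (p := p) F), xi} := by
  obtain ⟨y, hy⟩ := Ideal.mem_span_singleton'.1 ha
  obtain ⟨a', ha'⟩ := hF (thetaBmaxZero F p y)
  have h0 : fontaineTheta (integerC F) p (a - (p : Ainf (p := p) F) * a') = 0 := by
    rw [map_sub, map_mul, map_natCast, ha', ← thetaBmaxZero_algebraMap, ← hy, map_mul, thetaBmaxZero_natCast,
      mul_comm, sub_self]
  obtain ⟨c, hc⟩ := xi_dvd_of_fontaineTheta_eq_zero h0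
  exact Ideal.mem_span_pair.2 ⟨a', c, by linear_combination -hc⟩

/-- **`𝔸_inf ∩ p·B⁰_max = (p, ξ)`.** [cite: Colmez1998Annals, §III.2] -/
theorem mem_span_p_xi_iff_algebraMap_mem (hF : Function.Surjective (fontaineTheta (integerC F) p)) (a : Ainf (p := p) F) :
    a ∈ Ideal.span {(p : Ainf (p := p) F), xi} ↔
      algebraMap (Ainf (p := p) F) (bmaxZero F p) a ∈ Ideal.span {(p : bmaxZero F p)} :=
  ⟨algebraMap_mem_span_of_mem_span_p_xi, mem_span_p_xi_of_algebraMap_mem hF⟩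

omit [CharZero F] in
/-- `θ(1) = 1 ∉ p𝒪_{ℂ_F}`: the ideal `(p, ξ)` of `𝔸_inf` is proper. [cite: Colmez1998Annals, §III.2] -/
theorem one_not_mem_span_p_xi : (1 : Ainf (p := p) F) ∉ Ideal.span {(p : Ainf (p := p) F), xi} := by
  intro h
  obtain ⟨u, v, huv⟩ := Ideal.mem_span_pair.1 h
  have h1 := congrArg (fontaineTheta (integerC F) p) huv
  rw [map_add, map_mul, map_mul, fontaineTheta_xi, mul_zero, add_zero, map_natCast, map_one] at h1
  exact (Fact.out : ¬ IsUnit (p : integerC F)) (IsUnit.of_mul_eq_one_right _ h1)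

/-- **`p·B⁰_max ≠ B⁰_max`** (`1 ∉ (p, ξ)𝔸_inf`). [cite: Colmez1998Annals, §III.2] -/
theorem span_natCast_bmaxZero_ne_top (hF : Function.Surjective (fontaineTheta (integerC F) p)) :
    Ideal.span {(p : bmaxZero F p)} ≠ ⊤ := fun h =>
  one_not_mem_span_p_xi (F := F) (p := p) (mem_span_p_xi_of_algebraMap_mem hF (by rw [map_one, h]; exact Submodule.mem_top))

/-! ### `θ` on `A_max = B_max⁺(F)` -/

variable (F p) in
/-- **Fontaine's `θ` on `A_max = B_max⁺(F)`**, the `p`-adically continuous extension of `θ|_{B⁰_max}` (adic-completion functoriality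
composed with `𝒪_{ℂ_F} ≅ (𝒪_{ℂ_F})^_(p)`, `𝒪_{ℂ_F}` being `p`-adically complete). [cite: Colmez1998Annals, §III.2] -/
def thetaBmaxPlus : BmaxPlus F p →+* integerC F where
  toFun x := (AdicCompletion.ofAlgEquiv (Ideal.span {(p : integerC F)})).symm
    (adicCompletionMap (Ideal.span {(p : bmaxZero F p)}) (Ideal.span {(p : integerC F)}) (thetaBmaxZero F p)
      map_thetaBmaxZero_span_le x)
  map_one' := by simp only [map_one]
  map_mul' x y := by simp only [map_mul]
  map_zero' := by simp only [map_zero]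
  map_add' x y := by simp only [map_add]

/-- Unfolding of `thetaBmaxPlus`. [cite: Colmez1998Annals, §III.2] -/
theorem thetaBmaxPlus_apply (x : BmaxPlus F p) :
    thetaBmaxPlus F p x = (AdicCompletion.ofAlgEquiv (Ideal.span {(p : integerC F)})).symm
      (adicCompletionMap (Ideal.span {(p : bmaxZero F p)}) (Ideal.span {(p : integerC F)}) (thetaBmaxZero F p)
        map_thetaBmaxZero_span_le x) := rfl

set_option maxHeartbeats 1600000 in
/-- **`θ` extends `θ|_{B⁰_max}`**: `θ(y) = θ⁰(y)` for `y ∈ B⁰_max`. [cite: Colmez1998Annals, §III.2] -/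
theorem thetaBmaxPlus_of (y : bmaxZero F p) :
    thetaBmaxPlus F p (AdicCompletion.of (Ideal.span {(p : bmaxZero F p)}) (bmaxZero F p) y) = thetaBmaxZero F p y := by
  rw [thetaBmaxPlus_apply, adicCompletionMap_of, AdicCompletion.ofAlgEquiv_symm_of]

set_option maxHeartbeats 1600000 in
/-- `θ` on the image of `B⁰_max` (algebra-map form). [cite: Colmez1998Annals, §III.2] -/
theorem thetaBmaxPlus_algebraMap (y : bmaxZero F p) :
    thetaBmaxPlus F p (algebraMap (bmaxZero F p) (BmaxPlus F p) y) = thetaBmaxZero F p y :=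
  thetaBmaxPlus_of y

set_option maxHeartbeats 1600000 in
/-- **`θ ∘ (𝔸_inf → A_max) = θ`.** [cite: Colmez1998Annals, §III.2] -/
theorem thetaBmaxPlus_ainfToBmaxPlus (a : Ainf (p := p) F) :
    thetaBmaxPlus F p (ainfToBmaxPlus F p a) = fontaineTheta (integerC F) p a := by
  rw [ainfToBmaxPlus_apply, thetaBmaxPlus_of, thetaBmaxZero_algebraMap]

set_option maxHeartbeats 1600000 in
/-- **Level formula: `θ(x) mod pⁿ = θ̄(x mod pⁿ)`.** [cite: Colmez1998Annals, §III.2] -/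
theorem mk_pow_thetaBmaxPlus (n : ℕ) (x : BmaxPlus F p) :
    Ideal.Quotient.mk (Ideal.span {(p : integerC F)} ^ n) (thetaBmaxPlus F p x) =
      Ideal.quotientMap (Ideal.span {(p : integerC F)} ^ n) (thetaBmaxZero F p)
        (pow_le_comap_pow_of_map_le (thetaBmaxZero F p) map_thetaBmaxZero_span_le n)
        (AdicCompletion.evalₐ (Ideal.span {(p : bmaxZero F p)}) n x) := by
  rw [thetaBmaxPlus_apply, AdicCompletion.mk_ofAlgEquiv_symm, evalₐ_adicCompletionMap]

set_option maxHeartbeats 1600000 in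
/-- **`θ(x) ≡ θ⁰(y) (mod pⁿ)` whenever `x ≡ y (mod pⁿ)`**, `y ∈ B⁰_max`. [cite: Colmez1998Annals, §III.2] -/
theorem thetaBmaxPlus_sub_mem_of_evalₐ_eq {n : ℕ} {x : BmaxPlus F p} {y : bmaxZero F p}
    (hx : AdicCompletion.evalₐ (Ideal.span {(p : bmaxZero F p)}) n x = Ideal.Quotient.mk _ y) :
    thetaBmaxPlus F p x - thetaBmaxZero F p y ∈ Ideal.span {(p : integerC F)} ^ n := by
  rw [← Ideal.Quotient.eq, mk_pow_thetaBmaxPlus, hx, Ideal.quotientMap_mk]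

omit [CharZero F] [Fact p.Prime] [Fact (¬ IsUnit (p : integerC F))] in
/-- An element of `𝒪_{ℂ_F}` divisible by every power of `p` vanishes (`𝒪_{ℂ_F}` is `p`-adically separated). [cite: Colmez1998Annals, §III.2] -/
theorem eq_zero_of_forall_mem_span_pow {c : integerC F} (h : ∀ n, c ∈ Ideal.span {(p : integerC F)} ^ n) : c = 0 :=
  IsHausdorff.haus (IsAdicComplete.toIsHausdorff (I := Ideal.span {(p : integerC F)})) c fun n => by
    rw [smul_eq_mul, Ideal.mul_top]; exact SModEq.zero.2 (h n)

set_option maxHeartbeats 1600000 in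
/-- **`θ(x) = 0` as soon as `x mod pⁿ ∈ ker θ⁰` for all `n`.** [cite: Colmez1998Annals, §III.2] -/
theorem thetaBmaxPlus_eq_zero_of_forall {x : BmaxPlus F p} (y : ℕ → bmaxZero F p)
    (hx : ∀ n, AdicCompletion.evalₐ (Ideal.span {(p : bmaxZero F p)}) n x = Ideal.Quotient.mk _ (y n))
    (hy : ∀ n, thetaBmaxZero F p (y n) = 0) : thetaBmaxPlus F p x = 0 :=
  eq_zero_of_forall_mem_span_pow fun n => by simpa [hy n] using thetaBmaxPlus_sub_mem_of_evalₐ_eq (hx n)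

/-! ### `θ(t) = 0` -/

/-- `θ(logTerm k) = 0` for `k ≥ 1` (the factor `(ξ/p)^k`). [cite: Colmez1998Annals, §III.2] -/
theorem thetaBmaxZero_logTerm {k : ℕ} (hk : k ≠ 0) : thetaBmaxZero F p (logTerm (F := F) (p := p) k) = 0 := by
  obtain ⟨j, rfl⟩ := Nat.exists_eq_succ_of_ne_zero hk
  rw [logTerm, map_mul, map_pow, thetaBmaxZero_omegaB, zero_pow (Nat.succ_ne_zero j), mul_zero]

/-- `θ(logSum N) = 0`. [cite: Colmez1998Annals, §III.2] -/
theorem thetaBmaxZero_logSum (N : ℕ) : thetaBmaxZero F p (logSum (F := F) (p := p) N) = 0 := by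
  rw [logSum, map_sum]
  exact sum_eq_zero fun k _ => thetaBmaxZero_logTerm (Nat.succ_ne_zero k)

set_option maxHeartbeats 1600000 in
/-- **`θ(t) = 0`** for Fontaine's `t = log[ε] ∈ A_max`. [cite: FontaineAsterisque223III, Exp. II §1.5.4] [cite: Colmez1998Annals, §III.2] -/
theorem thetaBmaxPlus_tBmax : thetaBmaxPlus F p (tBmax (F := F) (p := p)) = 0 := by
  refine thetaBmaxPlus_eq_zero_of_forall (fun n => logSum (p ^ n - 1)) (fun n => ?_) (fun n => thetaBmaxZero_logSum _)
  exact evalₐ_tBmax n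

set_option maxHeartbeats 1600000 in
/-- **`θ(a·t) = 0`** for `a ∈ 𝔸_inf`. [cite: Colmez1998Annals, §III.2] -/
theorem thetaBmaxPlus_ainfToBmaxPlus_mul_tBmax (a : Ainf (p := p) F) :
    thetaBmaxPlus F p (ainfToBmaxPlus F p a * tBmax) = 0 := by
  rw [map_mul, thetaBmaxPlus_tBmax, mul_zero]

end Literature.NumberTheory.PAdicHodge

end
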